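import Summits.BirchSwinnertonDyer.BirchSwinnertonDyer.Theorems.BiquadraticEisensteinDescentDeuringHoldsOfRowZero
import Summits.BirchSwinnertonDyer.BirchSwinnertonDyer.Theorems.BiquadraticEisensteinDescentDeuringRowZero
import Summits.BirchSwinnertonDyer.BirchSwinnertonDyer.Theorems.BiquadraticEisensteinDescentDeuringCoreOfDatumSet
import Literature.NumberTheory.EllipticCurves.SexticTwistGrossencharakterFrobenius
import Literature.NumberTheory.EllipticCurves.SexticTwistDeuringConductor
import Literature.NumberTheory.GaloisRepresentations.EisensteinSexticRamification
import HarnessLib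

set_option linter.dupNamespace false -- `Summit.BirchSwinnertonDyer.BirchSwinnertonDyer.Theorems.…` (summit = sub)
set_option autoImplicit false

/-!
# BED route, «Deuring-ψ lane»: the CORE of Deuring's theorem for the sextic twists `y² = x³ + k` OFF the good-at-`2` class
# (row `j = 0` of `Deuring_exists_heckeCharacter_of_maximalCM`, final assembly part 1/2)

Route `BiquadraticEisensteinDescent` of `Summits/BirchSwinnertonDyer` (crux `EisensteinHeartFlatCMInertBadKPrime`, stmt-BirchSwinnertonDyer-21341;
also `InertBadAtThree`, 19225). Cell `bsd-wall`, width seat `bsd-wall-cm-bed-w3` g17 (assembly; FILE C), consuming by name the sextic datum of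
seat w1 g15 (`EisensteinSextic.psi`, `SexticTwist.psi_frobenius`, `SexticTwist.not_isUnramifiedAt_heckeOfGross_psi_three`), the curve-side dictionary
of seat w4 g18 (`SexticTwist.dvd_conductorNorm_iff`, `…lFunction_apply_prime_eq_zero_of_dvd_conductorNorm`, the field bridge
`isCyclotomicExtension_three_of_isCMFieldOfJ_zero` / `discr_of_isCMFieldOfJ_zero`), the consumer `core_of_datum_set` (w4 g17) and FILE C
(`EisensteinSextic.not_isUnramifiedAt_heckeOfGross_psi_of_ne_three`, this seat). THEOREMS ONLY.

* ★★ `core_sextic_of_not_good` — for `k ∈ ℤ ∖ {0}` sixth-power-free with `k ∉ 16·(1 + 4ℤ)` (so `E^k : y² = x³ + k` is bad exactly at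
  `3`, at the primes `p ≥ 5` of `k`, and at `2`) and every `K` with `IsCMFieldOfJ K 0` (`= ℚ(√−3)`): a Hecke character `ψ` of `K` of infinity type
  `(1, 0)` with `L(s, ψ) = L(E^k, s)` on `re s > 3/2` — Ireland–Rosen's Theorem 18.7′ («`L(E, s) = L(s, χ)`») in the tree's idelic currency,
  `ψ = heckeOfGross` of `𝔭 ↦ (k/N𝔭)(4k/𝔭)₃ϖ_𝔭` modulo `(36k)`.

The good-at-`2` class `k = 16u`, `u ≡ 1 (mod 4)` (odd modulus `(9u)`, seats w1/w4) and the unconditional `Deuring_exists_heckeCharacter_of_maximalCM_holds`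
follow in the sequel. BSD is not proved by any of this; 21341 / 19225 stay conditional on their Katz / Hsieh binders.
References: [IrelandRosen1990] Ch. 18 §§3, 6, 7; [SilvermanATAEC1994] II Thm. 9.2, Thm. 10.5 (b), Ex. 2.30–2.32; [NeukirchANT1999] VII (6.14).
-/

noncomputable section

namespace Summit.BirchSwinnertonDyer.BirchSwinnertonDyer.Theorems.BiquadraticEisensteinDescentDeuringOfCore

open scoped NumberField
open NumberField IsDedekindDomain WeierstrassCurve
  Literature.NumberTheory.GaloisRepresentations Literature.NumberTheory.GaloisRepresentations.EisensteinSextic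
  Literature.NumberTheory.EllipticCurves

variable {K : Type} [Field K] [NumberField K]

/-- ★★ **The CORE of Deuring's theorem for `E^k : y² = x³ + k`, `k` sixth-power-free OFF the good-at-`2` class `16(1 + 4ℤ)`**, over every `K`
with `IsCMFieldOfJ K 0`: some Hecke character of infinity type `(1, 0)` has `L(s, ψ) = L(E^k, s)` for `re s > 3/2`.  Assembly of
`core_of_datum_set` with the datum `ψ₀ = (k/N·)(4k/·)₃ϖ` modulo `(36k)` (seat w1: Größencharakter property, Frobenius values at `p ∤ 6k`,
ramification at `λ ∣ 3`), the bad-prime dictionary of `E^k` (seat w4: bad `= {3} ∪ {p ≥ 5 : p ∣ k} ∪ {2}` off the good class, `a_p = 0` there) and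
the ramification of `ψ` above every `p ≠ 3` of `2k` (FILE C). [cite: IrelandRosen1990, Ch. 18 §7 (Theorem 4′, `L(E,s) = L(s,χ)`)]
[cite: SilvermanATAEC1994, Ch. II Thm. 9.2, Thm. 10.5 (b), Ex. 2.30–2.32] -/
theorem core_sextic_of_not_good {k : ℤ} (hk : k ≠ 0) (h6 : ∀ q : ℕ, q.Prime → ¬ (q : ℤ) ^ 6 ∣ k)
    (hng : ¬ ∃ u : ℤ, u % 4 = 1 ∧ k = 16 * u) (hK : IsCMFieldOfJ K 0) :
    ∃ ψ : HeckeCharacter K, ψ.HasInfinityType (fun _ ↦ 1) (fun _ ↦ 0) ∧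
      ∀ s : ℂ, 3 / 2 < s.re → heckeLFunction ψ s = ((⟨0, 0, 0, 0, (k : ℚ)⟩ : WeierstrassCurve ℚ)).LSeries s := by
  haveI := isCyclotomicExtension_three_of_isCMFieldOfJ_zero hK
  haveI : IsTotallyComplex K := IsCyclotomicExtension.Rat.isTotallyComplex K (n := 3) (by norm_num)
  haveI := isElliptic_mordellCurve (Int.cast_ne_zero.mpr hk : (k : ℚ) ≠ 0)
  obtain ⟨ζ, hζ⟩ := exists_isPrimitiveRoot_three (K := K)
  obtain ⟨c, hc⟩ := EisensteinSextic.exists_algEquiv_ne_one (K := K)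
  obtain ⟨w₀⟩ : Nonempty (InfinitePlace K) := inferInstance
  have hdisc : ∀ p : ℕ, p.Prime → p ≠ 3 → ¬ (p : ℤ) ∣ NumberField.discr K := fun p hp hp3 h => by
    rw [discr_of_isCMFieldOfJ_zero hK, dvd_neg, show (3 : ℤ) = ((3 : ℕ) : ℤ) by norm_num, Int.natCast_dvd_natCast] at h
    exact hp3 ((Nat.prime_dvd_prime_iff_eq hp Nat.prime_three).mp h)
  refine core_of_datum_set (mordellCurve (k : ℚ)) hK.1 hc (modulus_ne_bot hk) (isGrossencharakter_psi_one_zero hζ hk w₀)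
    (fun p hp hpN => ⟨SexticTwist.lFunction_apply_prime_eq_zero_of_dvd_conductorNorm hk h6 hp hpN, fun w hpw => ?_⟩)
    (fun p hp hpN => ?_)
  · -- bad primes: `3`, the primes `p ≥ 5` of `k`, and `2` (off the good class): `ψ` is ramified above each
    rcases (SexticTwist.dvd_conductorNorm_iff hk h6 hp).mp hpN with rfl | ⟨h5, hpk⟩ | ⟨rfl, hng'⟩
    · exact SexticTwist.not_isUnramifiedAt_heckeOfGross_psi_three hζ hk w₀ (by exact_mod_cast hpw)
    · have hp3 : p ≠ 3 := by omega
      have hw : modulus k ≤ w.asIdeal := by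
        rw [modulus_le_iff]
        obtain ⟨t, ht⟩ := hpk
        rw [ht, show ((6 * ((p : ℤ) * t) : ℤ) : 𝓞 K) = ((6 * t : ℤ) : 𝓞 K) * (p : 𝓞 K) by push_cast; ring]
        exact w.asIdeal.mul_mem_left _ hpw
      exact not_isUnramifiedAt_heckeOfGross_psi_of_ne_three hζ hk h6 w₀ hp hp3 hpw hw (fun h2 => by omega)
    · have hw : modulus k ≤ w.asIdeal := by
        rw [modulus_le_iff, show ((6 * k : ℤ) : 𝓞 K) = ((3 * k : ℤ) : 𝓞 K) * ((2 : ℕ) : 𝓞 K) by push_cast; ring]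
        exact w.asIdeal.mul_mem_left _ hpw
      exact not_isUnramifiedAt_heckeOfGross_psi_of_ne_three hζ hk h6 w₀ hp (by norm_num) hpw hw
        (fun _ ⟨u, hu1, hu2⟩ => hng' ⟨u, hu2, hu1⟩)
  · -- good primes: `p ∤ 6k` (off the good class), unramified in `K`, Frobenius values = w1's `psi_frobenius`
    obtain ⟨hp3, himp⟩ := SexticTwist.not_dvd_of_not_dvd_conductorNorm hk h6 hp hpN
    have hpk : ¬ (p : ℤ) ∣ 6 * k := fun h => hng (himp h).2
    exact ⟨hdisc p hp hp3, fun w hpw => SexticTwist.psi_frobenius hζ w₀.embedding hc hp hpk hpw⟩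

end Summit.BirchSwinnertonDyer.BirchSwinnertonDyer.Theorems.BiquadraticEisensteinDescentDeuringOfCore

end
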